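import Literature.Topology.FourManifolds.CorkDecompositionMiddleLevel
import HarnessLib

/-!
# The cork decomposition theorem from Milnor's rungs, (B) and (H4)

Topic `Literature/Topology/FourManifolds` (fact item `provefact-Literature.corkDecomposition`).

The printed proofs of the cork decomposition theorem `Literature.Topology.FourManifolds.corkDecomposition`
(`CorkTwist.lean`; Curtis–Freedman–Hsiang–Stong 1996, Matveyev 1996, Kirby 1996) begin with
5-dimensional handle trading — Matveyev, Proof of Theorem, first sentence: *"First, observe
that `U` has a handlebody with no 1- and 4-handles"*; Kirby §2: *"we can cancel all
0-handles and 5-handles [...] all 1-handles and 4-handles [...] `M_{1/2}` has all the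
2-handles below and all the 3-handles above"* —, i.e. with a Morse function on the
h-cobordism with index-`2` critical points below `1/2` and index-`3` critical points above
`1/2`.  That Morse function is supplied (`HCobordismHandlesTwoThree.lean`,
`Literature.Topology.FourManifolds.Cobordism.IsHCobordism.exists_isMorseFunction_two_three_ordered_of_milnor1965`)
by two rungs of Milnor's proof of the h-cobordism theorem that hold in dimension `5`:

* F81 `Literature.Topology.FourManifolds.Milnor1965_exists_isMorseFunction_two_le_index` (Milnor 1965, Thm. 8.1 at both ends /
  proof of Thm. 9.1, `dim W ≥ 5`; itself reduced to Thm. 2.5 and Thm. 8.1 at one end by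
  `Literature.Topology.FourManifolds.Milnor1965_exists_isMorseFunction_two_le_index_of_leaves`), and
* Thm. 4.8 `Literature.Topology.FourManifolds.Cobordism.Milnor1965_finalRearrangement`,

and from such a handlebody on the argument passes to the middle level (B)
(`Literature.Topology.FourManifolds.exists_dualSpheres_middleLevel_of_two_three`) and runs the
four-dimensional construction there (H4)
(`Literature.Topology.FourManifolds.Matveyev1996_partOne_and_fact_of_dualSpheres`), both of
`CorkDecompositionMiddleLevel.lean`.  Hence (this file):

* `Literature.Topology.FourManifolds.matveyev1996_partOne_and_fact_of_milnor1965`: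
  F81 ∧ Thm. 4.8 ∧ (B) ∧ (H4) ⟹ `Literature.Topology.FourManifolds.Matveyev1996_partOne_and_fact`;
* `Literature.Topology.FourManifolds.corkDecomposition_of_milnor1965`:
  **`corkDecomposition ⟸ F81 ∧ Thm. 4.8 ∧ (B) ∧ (H4)`**;
* `Literature.Topology.FourManifolds.corkDecomposition_of_milnor1965_leaves`: the same from the leaves Thm. 2.5
  (`Literature.Topology.FourManifolds.Cobordism.exists_isMorseFunction`), Thm. 8.1 at one end
  (`Literature.Topology.FourManifolds.Cobordism.Milnor1965_exists_isMorseFunction_two_le_index_left`), Thm. 4.8, (B) and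
  (H4).

All three Milnor rungs are meanwhile theorems of the tree (`Cobordism.exists_isMorseFunction_holds`,
`Milnor1965_exists_isMorseFunction_two_le_index_holds`, `Cobordism.Milnor1965_finalRearrangement_holds`),
so these reductions are kept for the record; the live frontier below `corkDecomposition` is
(B) ∧ (H4) (`matveyev1996_partOne_and_fact_of_middleLevel_leaves`, `CorkDecompositionProofs.lean`).

**Merge of the handlebody form (2026-08-15, D-0026 review).**  These theorems used to take,
in place of (B) and (H4), the intermediate named fact `Matveyev1996_partOne_and_fact_of_two_three`
of `CorkDecompositionHandlebody.lean` ("the handlebody form": `Matveyev1996_partOne_and_fact`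
with the two-three Morse function as an extra hypothesis).  Handle trading being discharged,
that fact had become unconditionally equivalent to `Matveyev1996_partOne_and_fact` — one proof
obligation counted twice — and the D-0026 review merged it back into its parent; its split
(B) ∧ (H4) takes its place here (`Matveyev1996_partOne_and_fact_of_dualSpheres.apply_two_three`).

## References

* R. Matveyev, *A decomposition of smooth simply-connected h-cobordant 4-manifolds*,
  J. Differential Geom. 44 (1996) 571–582; arXiv:dg-ga/9505001, Theorem 1, Proof of Theorem
  (first sentence, pp. 1–2) and Fact 1 (p. 3). [Matveyev1996]
* R. Kirby, *Akbulut's corks and h-cobordisms of smooth, simply connected 4-manifolds*, Turkish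
  J. Math. 20 (1996) 85–93; arXiv:math/9712231, §2 (handle cancellation), §§3–4. [KirbyCorks1996]
* C. L. Curtis, M. H. Freedman, W.-C. Hsiang, R. Stong, *A decomposition theorem for h-cobordant
  smooth simply-connected compact 4-manifolds*, Invent. Math. 123 (1996) 343–348. [CurtisFreedmanHsiangStong1996]
* J. Milnor, *Lectures on the h-cobordism theorem*, Princeton (1965), Thm. 2.5, Thm. 4.8,
  Thm. 8.1, proof of Thm. 9.1. [MilnorHCobordism1965]
-/

noncomputable section

namespace Literature.Topology.FourManifolds

universe u

/-- **`Matveyev1996_partOne_and_fact` from F81, Thm. 4.8, (B) and (H4)** — the structure of the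
printed proofs: the first sentence ("*`U` has a handlebody with no 1- and 4-handles.  Let `N`
be the middle level of `U` between 2- and 3-handles*", Matveyev; "*we can cancel all
0-handles and 5-handles [...] all 1-handles and 4-handles [...] `M_{1/2}` has all the
2-handles below and all the 3-handles above*", Kirby §2) supplied by Milnor's rungs
(`Literature.Topology.FourManifolds.Cobordism.IsHCobordism.exists_isMorseFunction_two_three_ordered_of_milnor1965`), followed by
the passage to the middle level (B) and the four-dimensional construction (H4)
(`Matveyev1996_partOne_and_fact_of_dualSpheres.apply_two_three`).
[cite: Matveyev1996, Proof of Theorem, first sentence (arXiv p. 1)] [cite: KirbyCorks1996, §2]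
[cite: MilnorHCobordism1965, proof of Thm. 9.1 (PDF p. 57) and Thm. 4.8 (PDF p. 25)] -/
theorem matveyev1996_partOne_and_fact_of_milnor1965
    (h81 : Milnor1965_exists_isMorseFunction_two_le_index.{u})
    (hR : Cobordism.Milnor1965_finalRearrangement.{u})
    (hB : exists_dualSpheres_middleLevel_of_two_three.{u})
    (h4 : Matveyev1996_partOne_and_fact_of_dualSpheres.{u}) :
    Matveyev1996_partOne_and_fact.{u} := by
  intro X₁ X₂ _ _ _ _ _ _ _ _ _ _ _ _ _ _ hcob
  obtain ⟨c, hc⟩ := hcob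
  obtain ⟨f, hf, hind⟩ := hc.exists_isMorseFunction_two_three_ordered_of_milnor1965 h81 hR
  exact h4.apply_two_three hB c f hc hf hind

/-- **The cork decomposition theorem from F81, Thm. 4.8, (B) and (H4).**
`Literature.Topology.FourManifolds.corkDecomposition` (h-cobordant simply connected closed smooth 4-manifolds differ by a
cork twist along a compact contractible `C`; Curtis–Freedman–Hsiang–Stong 1996, Matveyev 1996)
follows from Milnor's rungs F81 (`Literature.Topology.FourManifolds.Milnor1965_exists_isMorseFunction_two_le_index`) and
Thm. 4.8 (`Literature.Topology.FourManifolds.Cobordism.Milnor1965_finalRearrangement`) — which give the handlebody with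
2-handles below and 3-handles above the middle level —, the middle level (B) and the
four-dimensional construction (H4) (the middle-level construction and Kirby calculus),
everything else (Matveyev's fig. 2, boundary connected sums, `X # S⁴ ≅ X`, collars, seam
adaptation) being proved in the tree (`Literature.Topology.FourManifolds.corkDecomposition_of_partOne_and_fact`).
[cite: Matveyev1996, Theorem 1 and its proof (arXiv pp. 1–3)]
[cite: MilnorHCobordism1965, proof of Thm. 9.1 (PDF p. 57) and Thm. 4.8 (PDF p. 25)] -/
theorem corkDecomposition_of_milnor1965
    (h81 : Milnor1965_exists_isMorseFunction_two_le_index.{u})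
    (hR : Cobordism.Milnor1965_finalRearrangement.{u})
    (hB : exists_dualSpheres_middleLevel_of_two_three.{u})
    (h4 : Matveyev1996_partOne_and_fact_of_dualSpheres.{u}) : corkDecomposition.{u} :=
  corkDecomposition_of_partOne_and_fact (matveyev1996_partOne_and_fact_of_milnor1965 h81 hR hB h4)

/-- **The cork decomposition theorem from the leaves**: Thm. 2.5
(`Literature.Topology.FourManifolds.Cobordism.exists_isMorseFunction`), Thm. 8.1 at one end
(`Literature.Topology.FourManifolds.Cobordism.Milnor1965_exists_isMorseFunction_two_le_index_left`), Thm. 4.8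
(`Literature.Topology.FourManifolds.Cobordism.Milnor1965_finalRearrangement`), the middle level (B) and the
four-dimensional construction (H4).
[cite: Matveyev1996, Theorem 1 and its proof (arXiv pp. 1–3)]
[cite: MilnorHCobordism1965, proof of Thm. 9.1 (PDF p. 57), with Thm. 2.5, Thm. 8.1, Thm. 4.8] -/
theorem corkDecomposition_of_milnor1965_leaves
    (h25 : ∀ {n : ℕ} {M N : Type u} [TopologicalSpace M]
      [ChartedSpace (EuclideanSpace ℝ (Fin n)) M] [TopologicalSpace N]
      [ChartedSpace (EuclideanSpace ℝ (Fin n)) N],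
      Cobordism.exists_isMorseFunction (n := n) (M := M) (N := N))
    (h81 : Cobordism.Milnor1965_exists_isMorseFunction_two_le_index_left.{u})
    (hR : Cobordism.Milnor1965_finalRearrangement.{u})
    (hB : exists_dualSpheres_middleLevel_of_two_three.{u})
    (h4 : Matveyev1996_partOne_and_fact_of_dualSpheres.{u}) : corkDecomposition.{u} :=
  corkDecomposition_of_milnor1965 (Milnor1965_exists_isMorseFunction_two_le_index_of_leaves h25 h81)
    hR hB h4

end Literature.Topology.FourManifolds

end
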